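import Mathlib
import HarnessLib
import Summits.HubbardSuperconductivity.HubbardSuperconductivity.Theorems.KLProgrammeKLRegimeSplitChildOneStepV6
import Summits.HubbardSuperconductivity.HubbardSuperconductivity.Theorems.KLProgrammeKLRegimeSplitPairArrayV4
import Summits.HubbardSuperconductivity.HubbardSuperconductivity.Theorems.KLProgrammeKLRegimeBetaSplitStubPairArrayAtRegime

/-!
# Route `KLProgramme` — crux K3, child 1 `KLRegimeBetaSplit` CLOSED on the (0,1)-slots: `BetaSplitP Pr W` for EVERY predicate bundle whose
# split slot is implied by `BetaSplitAtS` and whose engine slot implies `EngineBoundsAtV4S` — in particular `BetaSplitP klPredsV6 klWindowC`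

Cell gate-hubbard-kl, seat hubbard-kl-r2d-p1 (child-1 owner).  The composition of the landed pieces with the constant choices of the birth
skeleton of stmt-HubbardSuperconductivity-19635 (HOME evidence `KLRegimeBetaSplit.lean`): for every `G` child 1 takes
`P = (Klam, C_W, Cd, t₀) = (2·CF + 3, cW4(G), cE4 + 1, 0)` with row 0′'s V4 polynomial
`cW4 = 8(Σ_χ(abot+atop)+1) + 17(aplus Klam² Z + cloc Klam²(1−4^{−θ})⁻¹ + 1) + 1 + 235·CF·Klam²`; for every `Q` the NO-ONSET ceiling
`c₀ = ln 4 / (160·Crow4·(bhi+1))`, `Crow4 = (Σ_χ(abot+atop)+1) + 2(aplus Klam² Z + cloc Klam²(1−4^{−θ})⁻¹ + 1) + 1 + 27·CF·Klam²` — this is where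
`β ≤ e^{c/U²}` (via `IsKLRegime U c (−n)`: `U²·n·ln 4 ≤ c`) is spent; then `U₀ = min(1, 1/(2·CR·Klam³+1), 1/(Q.cE4+1), 1/(Dval+1))`,
`Dval = C_W + CF·C_W + CF·Klam²`, the volume threshold `L₁ β U = ⌈17·Σ_{j ≤ n_β} CL β j/U²⌉₊`, `M₁ = 0`.  At a regime scale: (B1-v2) `PairArrayAt n`
from row 0′ on the V4 engine slot (`pairArrayAt_of_engineBoundsV4S_explicit`, this seat) fed with the history's and the scale-`n` engine bounds;
then p1b's `betaSplitAtS_of_engineV4S` (= p1's `endpointLineS_of` + `firstMoments_of_engineFirstMoments`).  **`betaSplitP_of_slotsS`** (generic),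
**`betaSplitP_klPredsV6`** (`: BetaSplitP klPredsV6 W` for every window `W`).  The route item `KLRegimeBetaSplitV6` (when filed) closes by name with
a one-line Theorems file.  Everything is proved; no definitions.
-/

noncomputable section

namespace Summit.HubbardSuperconductivity.HubbardSuperconductivity.Theorems.KLRegimeSplit

set_option linter.dupNamespace false -- summit = problem name (single-conjunct summit), D-0017

open Real Finset Literature.MathematicalPhysics.QuantumLattice Literature.Probability.LatticeModels
open Summit.HubbardSuperconductivity.HubbardSuperconductivity.Theorems.KLProgrammeLegKernels
open Summit.HubbardSuperconductivity.HubbardSuperconductivity.Theorems.DispersionFlow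

/-! ## Arithmetic -/

/-- From `U ≤ 1/(X+1)` with `X ≥ 0`, `U ≥ 0`: `X·U ≤ 1`. -/
theorem klbs_mul_le_one_of_le_inv {X U : ℝ} (hX : 0 ≤ X) (hU : 0 ≤ U) (h : U ≤ 1 / (X + 1)) : X * U ≤ 1 := by
  have hX1 : 0 < X + 1 := by linarith
  have h1 : (X + 1) * U ≤ 1 := by
    calc (X + 1) * U ≤ (X + 1) * (1 / (X + 1)) := mul_le_mul_of_nonneg_left h hX1.le
      _ = 1 := by field_simp
  nlinarith

/-- **The no-onset line** (where `β ≤ e^{c/U²}` is spent): `IsKLRegime U c (−n)` (`U²·n·ln 4 ≤ c`) and `160·Crow·(bhi+1)·c ≤ ln 4` give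
`8·20·(Crow·U²)·(bhi·n) ≤ 1`. -/
theorem klbs_noOnset_line {Crow bhi U c : ℝ} {n : ℕ} (hCrow : 0 ≤ Crow) (hbhi : 0 ≤ bhi) (hKL : IsKLRegime U c (-(n : ℤ)))
    (hc : 160 * Crow * (bhi + 1) * c ≤ Real.log 4) : 8 * 20 * (Crow * U ^ 2) * (bhi * n) ≤ 1 := by
  have hlog4 : 0 < Real.log 4 := Real.log_pos (by norm_num)
  have hreg : U ^ 2 * (n : ℝ) * Real.log 4 ≤ c := by
    have h := hKL
    unfold IsKLRegime at h
    have habs : |((-(n : ℤ) : ℤ) : ℝ)| = (n : ℝ) := by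
      rw [Int.cast_neg, Int.cast_natCast, abs_neg, Nat.abs_cast]
    rwa [habs] at h
  have hn0 : (0 : ℝ) ≤ n := Nat.cast_nonneg n
  have h2 : 160 * Crow * bhi * (U ^ 2 * n) * Real.log 4 ≤ 160 * Crow * bhi * c := by
    have := mul_le_mul_of_nonneg_left hreg (by positivity : (0 : ℝ) ≤ 160 * Crow * bhi)
    nlinarith
  have hc0 : 0 ≤ c := le_trans (by positivity) hreg
  have h3 : 160 * Crow * bhi * c ≤ 160 * Crow * (bhi + 1) * c := by nlinarith
  have h5 : 8 * 20 * (Crow * U ^ 2) * (bhi * n) * Real.log 4 ≤ 1 * Real.log 4 := by nlinarith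
  exact le_of_mul_le_mul_right h5 hlog4

/-- **The value/iso constants**: with `Klam = 2·CF + 3` and `(C_W + CF·C_W + CF·Klam²)·U ≤ 1`, `U ≥ 0`:
`2U + C_W U² ≤ Klam·U` and `CF·(2U + C_W U²) + CF·(Klam U)² ≤ Klam·U`. -/
theorem klbs_value_consts {CF CW Klam U : ℝ} (hCF : 0 ≤ CF) (hCW : 0 ≤ CW) (hK : Klam = 2 * CF + 3) (hU : 0 ≤ U)
    (hD : (CW + CF * CW + CF * Klam ^ 2) * U ≤ 1) :
    2 * U + CW * U ^ 2 ≤ Klam * U ∧ CF * (2 * U + CW * U ^ 2) + CF * (Klam * U) ^ 2 ≤ Klam * U := by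
  have hK2 : 0 ≤ Klam ^ 2 := sq_nonneg _
  have h1 : CW * U ≤ 1 := by nlinarith [mul_nonneg hCF hCW, mul_nonneg hCF hK2]
  have h2 : (CF * CW + CF * Klam ^ 2) * U ≤ 1 := by nlinarith
  constructor
  · have h3 : CW * U * U ≤ 1 * U := mul_le_mul_of_nonneg_right h1 hU
    have h4 : 3 * U ≤ Klam * U := by rw [hK]; nlinarith
    have e : 2 * U + CW * U ^ 2 = 2 * U + CW * U * U := by ring
    rw [e]; linarith
  · have h3 : (CF * CW + CF * Klam ^ 2) * U * U ≤ 1 * U := mul_le_mul_of_nonneg_right h2 hU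
    have h4 : (2 * CF + 1) * U ≤ Klam * U := by rw [hK]; nlinarith
    have e : CF * (2 * U + CW * U ^ 2) + CF * (Klam * U) ^ 2 = 2 * CF * U + (CF * CW + CF * Klam ^ 2) * U * U := by ring
    rw [e]; linarith

/-! ## The child-1 theorem, generic in the bundle -/

/-- **Child 1 on the (0,1)-slots, for every bundle and window.**  If the bundle's split slot is implied by `BetaSplitAtS` and its engine
slot implies `EngineBoundsAtV4S` (for `klPredsV6` both by `rfl`), then `BetaSplitP Pr W`: for every `G` there are `P`, for every `Q` a
no-onset `c₀`, for every `c ≤ c₀`, `R` a `U₀` and thresholds such that at every regime scale the history and the scale-`n` engine output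
give the split at scale `n`. -/
theorem betaSplitP_of_slotsS {Pr : Preds} {W : Set ℝ}
    (hs : ∀ (L M : ℕ) [NeZero L] [NeZero M] (G : GeoConsts) (P : SplitConsts) (Q : EngConsts) (β U μ : ℝ) (K : TrigPolyC4v) (n : ℕ),
      BetaSplitAtS L M G P Q β U μ K n → Pr.split L M G P Q β U μ K n)
    (he : ∀ (L M : ℕ) [NeZero L] [NeZero M] (G : GeoConsts) (P : SplitConsts) (Q : EngConsts) (β U μ : ℝ) (K : TrigPolyC4v) (n : ℕ),
      Pr.engine L M G P Q β U μ K n → EngineBoundsAtV4S L M G P Q β U μ K n) :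
    BetaSplitP Pr W := by
  intro G hG
  -- nonnegativity of the `G`-constants
  have hCF : 0 ≤ G.CF := hG.2.2.2.2.2.2.2.2.2.2.2.2.2.1
  have hcloc : 0 ≤ G.cloc := hG.2.2.2.2.1
  have haplus : 0 ≤ G.aplus := hG.2.2.2.2.2.2.2.2.2.2.1
  have hθ : 0 < G.θ := hG.2.2.2.2.2.1
  have hbhi : 0 ≤ G.bhi := le_trans hG.2.2.1 hG.2.2.2.1
  have hcE4 : 0 ≤ G.cE4 := hG.2.2.2.2.2.2.2.2.2.2.2.2.2.2.2.2.1
  have hZ : 0 ≤ G.Z := le_trans (sum_nonneg fun j _ => hG.2.2.2.2.2.2.2.2.1 j) (hG.2.2.2.2.2.2.2.2.2.1 0)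
  have hab : 0 ≤ ∑ χ : D4Irrep, (G.abot χ + G.atop χ) := sum_nonneg fun χ _ => add_nonneg (hG.2.1 χ) (hG.1 χ)
  have hg : 0 ≤ (1 - (4 : ℝ) ^ (-G.θ))⁻¹ :=
    inv_nonneg.2 (by have := Real.rpow_lt_one_of_one_lt_of_neg (x := (4 : ℝ)) (by norm_num) (by linarith : -G.θ < 0); linarith)
  -- the induction constants `P` (kept opaque)
  obtain ⟨Klam, hKlam⟩ : ∃ x : ℝ, x = 2 * G.CF + 3 := ⟨_, rfl⟩
  have hKlam1 : 1 ≤ Klam := by rw [hKlam]; linarith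
  have hKlam0 : 0 ≤ Klam := zero_le_one.trans hKlam1
  have hK2 : 0 ≤ Klam ^ 2 := sq_nonneg _
  have hx1 : 0 ≤ G.aplus * Klam ^ 2 * G.Z := mul_nonneg (mul_nonneg haplus hK2) hZ
  have hx2 : 0 ≤ G.cloc * Klam ^ 2 * (1 - (4 : ℝ) ^ (-G.θ))⁻¹ := mul_nonneg (mul_nonneg hcloc hK2) hg
  obtain ⟨CW, hCW⟩ : ∃ x : ℝ, x = 8 * (∑ χ : D4Irrep, (G.abot χ + G.atop χ) + 1) +
      17 * (G.aplus * Klam ^ 2 * G.Z + G.cloc * Klam ^ 2 * (1 - (4 : ℝ) ^ (-G.θ))⁻¹ + 1) + 1 + 235 * (G.CF * Klam ^ 2) := ⟨_, rfl⟩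
  have hCW0 : 0 ≤ CW := by rw [hCW]; positivity
  refine ⟨⟨Klam, CW, G.cE4 + 1, 0⟩, ⟨hKlam1, hCW0, by positivity⟩, ?_⟩
  intro Q hQ
  have hPWF : (⟨Klam, CW, G.cE4 + 1, 0⟩ : SplitConsts).WF := ⟨hKlam1, hCW0, by positivity⟩
  have hCR : 0 ≤ Q.CR := hQ.2.1
  have hQcE4 : 0 ≤ Q.cE4 := hQ.2.2.2.1
  have hCL : ∀ β n, 0 ≤ Q.CL β n := hQ.2.2.2.2.2.2.2
  -- the no-onset constant `c₀`
  obtain ⟨Crow, hCrow_def⟩ : ∃ x : ℝ, x = (∑ χ : D4Irrep, (G.abot χ + G.atop χ) + 1) +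
      2 * (G.aplus * Klam ^ 2 * G.Z + G.cloc * Klam ^ 2 * (1 - (4 : ℝ) ^ (-G.θ))⁻¹ + 1) + 1 + 27 * (G.CF * Klam ^ 2) := ⟨_, rfl⟩
  have hCrow1 : 1 ≤ Crow := by rw [hCrow_def]; nlinarith [mul_nonneg hCF hK2]
  have hCrow : 0 ≤ Crow := zero_le_one.trans hCrow1
  have hlog4 : 0 < Real.log 4 := Real.log_pos (by norm_num)
  refine ⟨Real.log 4 / (160 * Crow * (G.bhi + 1)), by positivity, ?_⟩
  intro c hc hcc₀ R hR
  -- `U₀`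
  obtain ⟨Dval, hDval_def⟩ : ∃ x : ℝ, x = CW + G.CF * CW + G.CF * Klam ^ 2 := ⟨_, rfl⟩
  have hDval : 0 ≤ Dval := by rw [hDval_def]; positivity
  obtain ⟨U₀, hU₀_def⟩ : ∃ x : ℝ, x = min 1 (min (1 / (2 * Q.CR * Klam ^ 3 + 1)) (min (1 / (Q.cE4 + 1)) (1 / (Dval + 1)))) :=
    ⟨_, rfl⟩
  have hU₀ : 0 < U₀ := by
    rw [hU₀_def]
    exact lt_min one_pos (lt_min (by positivity) (lt_min (by positivity) (by positivity)))
  refine ⟨U₀, hU₀, fun β U => ⌈17 * (∑ j ∈ range (nScales β + 1), Q.CL β j) / U ^ 2⌉₊, fun _ _ _ => 0, ?_⟩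
  intro μ hμ U hU hUle β hβmin hβc K hK L M _ _ hL hM n hn hKL hHist hE hT
  -- the smallness lines out of `U ≤ U₀`
  rw [hU₀_def] at hUle
  have hU1 : U ≤ 1 := hUle.trans (min_le_left _ _)
  have hUa : |U| = U := abs_of_pos hU
  have hUCR : 2 * Q.CR * Klam ^ 3 * |U| ≤ 1 := by
    rw [hUa]
    exact klbs_mul_le_one_of_le_inv (by positivity) hU.le (hUle.trans ((min_le_right _ _).trans (min_le_left _ _)))
  have hUcE4 : Q.cE4 * |U| ≤ 1 := by
    rw [hUa]
    exact klbs_mul_le_one_of_le_inv hQcE4 hU.le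
      (hUle.trans ((min_le_right _ _).trans ((min_le_right _ _).trans (min_le_left _ _))))
  have hUD : Dval * U ≤ 1 :=
    klbs_mul_le_one_of_le_inv hDval hU.le
      (hUle.trans ((min_le_right _ _).trans ((min_le_right _ _).trans (min_le_right _ _))))
  have hc' : 160 * Crow * (G.bhi + 1) * c ≤ Real.log 4 := by
    have hpos : 0 < 160 * Crow * (G.bhi + 1) := by positivity
    have := (le_div_iff₀ hpos).1 hcc₀
    linarith
  -- the engine bounds at every scale `j ≤ n` (history + the scale-`n` hypothesis)
  have hEn : EngineBoundsAtV4S L M G ⟨Klam, CW, G.cE4 + 1, 0⟩ Q β U μ K n := he L M G _ Q β U μ K n hE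
  have hEall : ∀ j ≤ n, EngineBoundsAtV4S L M G ⟨Klam, CW, G.cE4 + 1, 0⟩ Q β U μ K j := by
    intro j hj
    rcases Nat.lt_or_ge j n with hlt | hge
    · exact he L M G _ Q β U μ K j (hHist j hlt).2.2.1
    · have : j = n := le_antisymm hj hge
      subst this
      exact hEn
  -- (B1-v2) from row 0′ on the V4 engine slot, in the regime
  have hLline : 17 * ∑ j ∈ range n, Q.CL β j / L ≤ U ^ 2 := klbs_volume_line hCL hU hn hL
  have hsmall : 8 * 20 * (((∑ χ : D4Irrep, (G.abot χ + G.atop χ) + 1) +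
      2 * (G.aplus * Klam ^ 2 * G.Z + G.cloc * Klam ^ 2 * (1 - (4 : ℝ) ^ (-G.θ))⁻¹ + 1) + 1 +
        27 * (G.CF * Klam ^ 2)) * U ^ 2) * (G.bhi * n) ≤ 1 := by
    rw [← hCrow_def]; exact klbs_noOnset_line hCrow hbhi hKL hc'
  have hB1 : PairArrayAt L M ⟨Klam, CW, G.cE4 + 1, 0⟩ β U μ K n :=
    pairArrayAt_of_engineBoundsV4S_explicit L M hG hPWF hQ hU.le hn hEall hUCR hLline hsmall (by rw [hCW])
  -- the per-scale step (p1b/p1): value line, iso endpoint line, first moments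
  have hUD' : (CW + G.CF * CW + G.CF * Klam ^ 2) * U ≤ 1 := by rwa [hDval_def] at hUD
  obtain ⟨hKval, harith⟩ := klbs_value_consts hCF hCW0 hKlam hU.le hUD'
  have hB : BetaSplitAtS L M G ⟨Klam, CW, G.cE4 + 1, 0⟩ Q β U μ K n := by
    refine betaSplitAtS_of_engineV4S L M ⟨Klam, CW, G.cE4 + 1, 0⟩ (by positivity) hKlam0 hB1 hEn ?_ ?_ ?_
    · show G.CF * (2 * |U| + CW * U ^ 2) + G.CF * (Klam * U) ^ 2 ≤ Klam * |U|
      rw [hUa]; exact harith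
    · show 2 * |U| + CW * U ^ 2 ≤ Klam * |U|
      rw [hUa]; exact hKval
    · show G.cE4 + Q.cE4 * |U| ≤ G.cE4 + 1
      linarith
  exact hs L M G _ Q β U μ K n hB

/-- **Child 1 at the V6 bundle**: `BetaSplitP klPredsV6 W` for every covariance window `W` (in particular `klWindowC`: the route item
`KLRegimeBetaSplitV6`). -/
theorem betaSplitP_klPredsV6 (W : Set ℝ) : BetaSplitP klPredsV6 W :=
  betaSplitP_of_slotsS (Pr := klPredsV6) (fun _ _ _ _ _ _ _ _ _ _ _ _ h => h) (fun _ _ _ _ _ _ _ _ _ _ _ _ h => h)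

end Summit.HubbardSuperconductivity.HubbardSuperconductivity.Theorems.KLRegimeSplit

end
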